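import Literature.NumberTheory.Automorphic.FuchsianEisensteinGrowth
import Literature.NumberTheory.Automorphic.FuchsianCuspidalSubspace

/-!
# The constant terms of the Eisenstein series of a finite volume Fuchsian group: `δ_𝔞𝔟 y^s + φ_𝔞𝔟(s) y^{1-s}`
(Iwaniec, *Spectral Methods of Automorphic Forms*, GSM 53, Theorem 3.1 & (3.4)–(3.5), PDF p. 41;
Theorem 3.4 & (3.20)–(3.22), PDF pp. 45–46; (1.23), PDF p. 17; §6.1 (the Fourier expansion
`E_𝔞(σ_𝔟z, s) = δ_𝔞𝔟 y^s + φ_𝔞𝔟(s) y^{1-s} + E_𝔞^*(σ_𝔟z, s)` feeding (6.1)–(6.6)), PDF p. 84)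

Seventh brick of the series `FuchsianGroupCusps` / `FuchsianEisensteinSeries` /
`FuchsianIncompleteEisenstein` / `FuchsianEisensteinGrowth` / `FuchsianIncompleteEisensteinCusp` /
`FuchsianEisensteinUniqueness` towards the general finite-volume cases of `Iwaniec2002_thm_7_4` /
`Iwaniec2002_eq_12_5` / `Iwaniec2002_thm_12_1`: the **scattering coefficients `φ_𝔞𝔟(s)`** of a
GENERAL discrete `Γ ≤ SL₂(ℝ)` (`-1 ∈ Γ`) with a system of inequivalent cusps `𝔞ᵢ = σᵢ∞`
(width-one scaling matrices, `FuchsianCuspZones.exists_cuspSystem`), for `Re s > 1`, and the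
zero-th Fourier coefficient of `E_𝔞ᵢ` at every cusp `𝔞ⱼ`:

  `∫₀¹ E_𝔞ᵢ(σⱼ(x + iy), s) dx = δᵢⱼ y^s + φᵢⱼ(s) y^{1-s}`  for all `y > 0`

(`cuspMeanAt_eisCusp`, with `Fuchsian.cuspMeanAt` of `FuchsianCuspidalSubspace`), obtained
WITHOUT the Kloosterman-sum formula (3.21)–(3.22) for `φ_𝔞𝔟(s)` (which we do not need): the cusp
mean of the automorphic `C²` eigenfunction `E_𝔞ᵢ(·, s)` in the frame of `𝔞ⱼ` solves the Euler
equation `y²a'' = -s(1-s)a`, hence equals `A y^s + B y^{1-s}` (Theorem 3.1 for a COMPLEX spectral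
parameter — the tree's `MaassFormZeroMode` treats real `s`), the a-priori growth
`|E_𝔞ᵢ(σⱼz, s) - δᵢⱼ y^s| ≤ (c(σ)/2)(y^{-σ} + y^{1-σ})` of `FuchsianEisensteinGrowth` forces
`A = δᵢⱼ`, and `B =: φᵢⱼ(s)` is read off at `y = 1`. Everything is PROVED; nothing is vendored;
no fact is introduced.

1. (§1) **The Euler equation with complex parameter** (`euler_ode_solution_cpow`): `a' = p`,
   `p' = q`, `y²q = -s(1-s)a` on `(0, ∞)`, `s ≠ 1/2` ⇒ `a = A y^s + B y^{1-s}` (two first integrals,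
   as `euler_ode_solution`; `ofReal_cpow_add`, the tree's `hasDerivAt_ofReal_cpow`).
2. (§2) **Zero-th mode of a `1`-periodic `C²` eigenfunction, complex eigenvalue**
   (`sq_mul_secondMode_complex`, `zeroMode_eq_cpow`), on top of the strip calculus of
   `MaassFormZeroMode` (`hasDerivAt_zeroMode`, `hasDerivAt_firstMode`, `integral_fderiv_fderiv_one_one`).
3. (§3) **The constant term of an automorphic eigenfunction at a width-one cusp**
   (`cuspMean_eigenfunction_eq`, `cuspMeanAt_eigenfunction_eq`): `T_1 ∈ Γ` resp. `T_1 ∈ σ⁻¹Γσ`,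
   `v ∈ 𝒜_s`, `s ≠ 1/2` ⇒ `∫₀¹ v(σ(x+iy)) dx = A y^s + B y^{1-s}` (Theorem 3.1 / (3.4), zero-th term;
   bridges `periodic_of_upperRightHom_mem`, `eigen_ofComplex_complex`, `cuspMean_eq_intervalIntegral`).
4. (§4) **`φᵢⱼ(s) = eisScattering Γ σ i j s := ∫₀¹ E_𝔞ᵢ(σⱼ(x + i), s) dx - δᵢⱼ`** (a definition for
   every `s`), **the constant-term theorem** `cuspMeanAt_eisCusp` for `Re s > 1`, the averaged
   growth bound `norm_cuspMeanAt_eisCusp_sub_le`, the elementary `coeff_eq_of_growth`, and the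
   uniform bound **`|φᵢⱼ(s)| ≤ c(σ)`**, `σ = Re s > 1` (`norm_eisScattering_le`).

Not here: holomorphy of `φᵢⱼ` in `s`, the symmetry `φᵢⱼ = φⱼᵢ` ((6.25), through (3.21) or
Maass–Selberg), the non-zero Fourier coefficients (Whittaker functions) and the exponentially
small remainder of (3.20), anything in `Re s ≤ 1`.

## References
* [Iwaniec2002] H. Iwaniec, *Spectral Methods of Automorphic Forms*, 2nd ed., GSM 53, AMS 2002,
  Thm 3.1 & (3.4)–(3.5), PDF p. 41; Thm 3.4 & (3.20)–(3.22), PDF pp. 45–46; (1.23), PDF p. 17;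
  §6.1, PDF p. 84 (held copy `book:iwaniec2002-spectral-methods-automorphic-forms`).

Mathlib: `HasDerivAt.cpow_const`, `Complex.cpow_add`, `Complex.cpow_one/two/zero`,
`intervalIntegral.norm_integral_le_of_norm_le_const`, `tendsto_rpow_neg_atTop`,
`Complex.norm_cpow_eq_rpow_re_of_pos`. Literature: `hasDerivAt_ofReal_cpow` (`InvariantLaplacian`);
`exists_const_of_hasDerivAt_zero_Ioi`, `hasDerivAt_zeroMode`, `hasDerivAt_firstMode`,
`integral_fderiv_fderiv_one_one`, `continuous_comp_horizontal`, `continuous_fderiv_fderiv_horizontal`,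
`im_pos_of_pt` (`MaassFormZeroMode`); `cuspMean`, `continuous_vadd₂` (`CuspidalSubspace`); `cuspMeanAt`,
`cuspMeanAt_apply` (`FuchsianCuspidalSubspace`); `eisCusp`, `isC2_and_eigen_eisCusp`,
`isAutomorphic_eisCusp` (`FuchsianEisensteinSeries`); `eisGrowthConst`, `norm_eisCusp_frame_sub_cpow_le`,
`norm_eisCusp_frame_le_of_ne` (`FuchsianEisensteinGrowth`); `upperRightHom_smul`,
`upperRightHom_one_mem_of_periods` (`FuchsianCuspZones`); `mem_conj_inv_iff` (`FuchsianGroupCusps`);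
`IsC2.comp_smul`, `hypLaplacian_comp_smul` (`InvariantLaplacian`); `toGL_smul_eq`
(`InvariantIntegralOperators`). The tree had the zero-th mode for REAL `s` (`zeroMode_eq_rpow`) and the
scattering coefficient of `SL₂(ℤ)` (`scatPhi`, explicit through `ζ`); nothing for complex `s` or a
general group (`lean search 'eisScattering|zeroMode_eq_cpow|euler_ode_solution_cpow|cuspMeanAt_eisCusp|scattering coeff'`).
-/

noncomputable section

namespace Literature.NumberTheory.Automorphic

open Filter _root_.MeasureTheory Real intervalIntegral Set
open scoped _root_.Topology

/-! ## 1. The Euler equation `y² a'' = -s(1-s) a` with a complex parameter -/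

section EulerODEComplex

/-- `y^{a+b} = y^a y^b` for `y > 0`. [folklore] -/
theorem ofReal_cpow_add {y : ℝ} (hy : 0 < y) (a b : ℂ) :
    (y : ℂ) ^ (a + b) = (y : ℂ) ^ a * (y : ℂ) ^ b :=
  Complex.cpow_add _ _ (Complex.ofReal_ne_zero.mpr hy.ne')

/-- **Solutions of the Euler equation with complex parameter.** If `a : (0,∞) → ℂ` is twice
differentiable with `a' = p`, `p' = q` and `y² q = -s(1-s) a`, `s ≠ 1/2` (`s ∈ ℂ`), then
`a(y) = A y^s + B y^{1-s}` (Iwaniec (1.23): the two solutions `y^s`, `y^{1-s}`; two explicit first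
integrals, as in `euler_ode_solution` for real `s`). [cite: Iwaniec2002, (1.23), PDF p. 17] -/
theorem euler_ode_solution_cpow {a p q : ℝ → ℂ} {s : ℂ} (hs : s ≠ 1 / 2)
    (ha : ∀ y : ℝ, 0 < y → HasDerivAt a (p y) y) (hp : ∀ y : ℝ, 0 < y → HasDerivAt p (q y) y)
    (hq : ∀ y : ℝ, 0 < y → (y : ℂ) ^ 2 * q y = -(s * (1 - s)) * a y) :
    ∃ A B : ℂ, ∀ y : ℝ, 0 < y → a y = A * (y : ℂ) ^ s + B * (y : ℂ) ^ (1 - s) := by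
  -- first integral: `c = p y^{1-s} + (s-1) a y^{-s}` is constant
  set c : ℝ → ℂ := fun y => p y * (y : ℂ) ^ (1 - s) + (s - 1) * a y * (y : ℂ) ^ (-s) with hc_def
  have hc : ∀ y : ℝ, 0 < y → HasDerivAt c 0 y := by
    intro y hy
    have h := ((hp y hy).fun_mul (hasDerivAt_ofReal_cpow hy (1 - s))).fun_add
      (((ha y hy).const_mul (s - 1)).fun_mul (hasDerivAt_ofReal_cpow hy (-s)))
    refine h.congr_deriv ?_
    set P : ℂ := (y : ℂ) ^ (-s - 1) with hP
    have e1 : (y : ℂ) ^ (1 - s) = (y : ℂ) ^ 2 * P := by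
      rw [hP, ← Complex.cpow_two, ← ofReal_cpow_add hy]; congr 1; ring
    have e2 : (y : ℂ) ^ (1 - s - 1) = (y : ℂ) * P := by
      rw [hP, show (1 : ℂ) - s - 1 = 1 + (-s - 1) by ring, ofReal_cpow_add hy, Complex.cpow_one]
    have e3 : (y : ℂ) ^ (-s) = (y : ℂ) * P := by
      rw [hP]
      conv_lhs => rw [show (-s : ℂ) = 1 + (-s - 1) by ring]
      rw [ofReal_cpow_add hy, Complex.cpow_one]
    have hq' := hq y hy
    rw [e1, e2, e3]
    linear_combination P * hq'
  obtain ⟨K, hK⟩ := exists_const_of_hasDerivAt_zero_Ioi hc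
  have h2s : (2 * s - 1 : ℂ) ≠ 0 := by
    intro h; apply hs; linear_combination h / 2
  set A : ℂ := K / (2 * s - 1) with hA
  have hKA : K = A * (2 * s - 1) := by rw [hA, div_mul_cancel₀ K h2s]
  -- second integral: `d = a y^{s-1} - A y^{2s-1}` is constant
  set d : ℝ → ℂ := fun y => a y * (y : ℂ) ^ (s - 1) - A * (y : ℂ) ^ (2 * s - 1) with hd_def
  have hd : ∀ y : ℝ, 0 < y → HasDerivAt d 0 y := by
    intro y hy
    have h := ((ha y hy).fun_mul (hasDerivAt_ofReal_cpow hy (s - 1))).fun_sub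
      ((hasDerivAt_ofReal_cpow hy (2 * s - 1)).const_mul A)
    refine h.congr_deriv ?_
    have hKy : c y = K := hK y hy
    simp only [hc_def] at hKy
    rw [hKA] at hKy
    have m1 : (y : ℂ) ^ (1 - s) * (y : ℂ) ^ (2 * s - 1 - 1) = (y : ℂ) ^ (s - 1) := by
      rw [← ofReal_cpow_add hy]; congr 1; ring
    have m2 : (y : ℂ) ^ (-s) * (y : ℂ) ^ (2 * s - 1 - 1) = (y : ℂ) ^ (s - 1 - 1) := by
      rw [← ofReal_cpow_add hy]; congr 1; ring
    linear_combination ((y : ℂ) ^ (2 * s - 1 - 1)) * hKy - p y * m1 - ((s - 1) * a y) * m2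
  obtain ⟨B, hB⟩ := exists_const_of_hasDerivAt_zero_Ioi hd
  refine ⟨A, B, fun y hy => ?_⟩
  have hBy := hB y hy
  simp only [hd_def] at hBy
  have m3 : (y : ℂ) ^ (s - 1) * (y : ℂ) ^ (1 - s) = 1 := by
    rw [← ofReal_cpow_add hy, show s - 1 + (1 - s) = (0 : ℂ) by ring, Complex.cpow_zero]
  have m4 : (y : ℂ) ^ (2 * s - 1) * (y : ℂ) ^ (1 - s) = (y : ℂ) ^ s := by
    rw [← ofReal_cpow_add hy]; congr 1; ring
  linear_combination ((y : ℂ) ^ (1 - s)) * hBy - a y * m3 + A * m4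

end EulerODEComplex

/-! ## 2. The zero-th Fourier mode of a periodic eigenfunction, complex eigenvalue -/

section ZeroModeComplex

open Laplacian

variable {F : ℂ → ℂ}

/-- The eigen-equation integrated over a period: `y² q(y) = -l a(y)` (`l ∈ ℂ`; as
`sq_mul_secondMode` for real `l`). [cite: Iwaniec2002, (1.22)–(1.23) & (3.5), PDF pp. 16–17, 41] -/
theorem sq_mul_secondMode_complex (hF : ContDiffOn ℝ 2 F {z : ℂ | 0 < z.im}) {l : ℂ}
    (hper : ∀ z : ℂ, 0 < z.im → F (z + 1) = F z)
    (heig : ∀ z : ℂ, 0 < z.im → (z.im : ℂ) ^ 2 * Δ F z + l * F z = 0) {y : ℝ} (hy : 0 < y) :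
    (y : ℂ) ^ 2 * ∫ x in (0 : ℝ)..1,
        fderiv ℝ (fderiv ℝ F) ((x : ℂ) + (y : ℂ) * Complex.I) Complex.I Complex.I =
      -l * ∫ x in (0 : ℝ)..1, F ((x : ℂ) + (y : ℂ) * Complex.I) := by
  have hpt : ∀ x : ℝ, (y : ℂ) ^ 2 *
      fderiv ℝ (fderiv ℝ F) ((x : ℂ) + (y : ℂ) * Complex.I) Complex.I Complex.I =
      -l * F ((x : ℂ) + (y : ℂ) * Complex.I) -
        (y : ℂ) ^ 2 * fderiv ℝ (fderiv ℝ F) ((x : ℂ) + (y : ℂ) * Complex.I) 1 1 := by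
    intro x
    have h := heig ((x : ℂ) + (y : ℂ) * Complex.I) (im_pos_of_pt hy)
    rw [laplacian_eq_fderiv_fderiv] at h
    have him : (((x : ℂ) + (y : ℂ) * Complex.I).im : ℂ) = (y : ℂ) := by simp
    rw [him] at h
    linear_combination h
  have hcF : Continuous fun x : ℝ => F ((x : ℂ) + (y : ℂ) * Complex.I) :=
    continuous_comp_horizontal hF.continuousOn hy
  rw [← intervalIntegral.integral_const_mul]
  simp_rw [hpt]
  rw [intervalIntegral.integral_sub ((hcF.const_mul _).intervalIntegrable _ _)
    (((continuous_fderiv_fderiv_horizontal hF hy 1 1).const_mul _).intervalIntegrable _ _),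
    intervalIntegral.integral_const_mul, intervalIntegral.integral_const_mul,
    integral_fderiv_fderiv_one_one hF hper hy, mul_zero, sub_zero]

/-- **Zero-th Fourier mode of a periodic eigenfunction, complex spectral parameter** (Theorem 3.1
/ (3.5) for the zero-th term): if `F` is `C²` and `1`-periodic on the upper half-plane with
`y² ΔF + s(1-s) F = 0`, `s ∈ ℂ ∖ {1/2}`, then `∫₀¹ F(x+iy) dx = A y^s + B y^{1-s}`.
[cite: Iwaniec2002, Thm 3.1 (3.4)–(3.5), PDF p. 41] -/
theorem zeroMode_eq_cpow (hF : ContDiffOn ℝ 2 F {z : ℂ | 0 < z.im}) {s : ℂ}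
    (hper : ∀ z : ℂ, 0 < z.im → F (z + 1) = F z)
    (heig : ∀ z : ℂ, 0 < z.im → (z.im : ℂ) ^ 2 * Δ F z + s * (1 - s) * F z = 0) (hs : s ≠ 1 / 2) :
    ∃ A B : ℂ, ∀ y : ℝ, 0 < y →
      (∫ x in (0 : ℝ)..1, F ((x : ℂ) + (y : ℂ) * Complex.I)) = A * (y : ℂ) ^ s + B * (y : ℂ) ^ (1 - s) :=
  euler_ode_solution_cpow hs (fun _ hy => hasDerivAt_zeroMode hF hy)
    (fun _ hy => hasDerivAt_firstMode hF hy) (fun _ hy => sq_mul_secondMode_complex hF hper heig hy)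

end ZeroModeComplex

/-! ## 3. The constant term of an automorphic eigenfunction at a width-one cusp -/

section CuspMean

open UpperHalfPlane Laplacian
open scoped MatrixGroups _root_.Pointwise

variable {Γ : Subgroup (GL (Fin 2) ℝ)}

/-- Periodicity `F(w + 1) = F(w)` of `v ∘ ofComplex` when `T_1 ∈ Γ` and `v` is automorphic. [folklore] -/
theorem periodic_of_upperRightHom_mem {v : ℍ → ℂ} (hv : IsAutomorphic Γ v)
    (hT : Matrix.GeneralLinearGroup.upperRightHom (1 : ℝ) ∈ Γ) (w : ℂ) (hw : 0 < w.im) :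
    (v ∘ ofComplex) (w + 1) = (v ∘ ofComplex) w := by
  have hw1 : 0 < (w + 1).im := by simpa using hw
  have h := hv _ hT ⟨w, hw⟩
  rw [Fuchsian.upperRightHom_smul] at h
  simp only [Function.comp_apply, ofComplex_apply_of_im_pos hw, ofComplex_apply_of_im_pos hw1]
  convert h using 2
  ext1
  simp [UpperHalfPlane.coe_vadd, add_comm]

/-- The eigen-equation on `ℂ` with complex eigenvalue. [folklore] -/
theorem eigen_ofComplex_complex {v : ℍ → ℂ} {l : ℂ} (heig : ∀ z : ℍ, hypLaplacian v z + l * v z = 0)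
    (w : ℂ) (hw : 0 < w.im) :
    (w.im : ℂ) ^ 2 * Δ (v ∘ ofComplex) w + l * (v ∘ ofComplex) w = 0 := by
  have h := heig ⟨w, hw⟩
  simp only [hypLaplacian] at h
  simpa [Function.comp_apply, ofComplex_apply_of_im_pos hw] using h

/-- The cusp mean at height `y` is the period integral of `v ∘ ofComplex` on the horocycle. [folklore] -/
theorem cuspMean_eq_intervalIntegral (f : ℍ → ℂ) {y : ℝ} (hy : 0 < y) :
    cuspMean f (ofComplex ⟨0, y⟩) = ∫ x in (0 : ℝ)..1, (f ∘ ofComplex) ((x : ℂ) + (y : ℂ) * Complex.I) := by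
  rw [cuspMean]
  refine intervalIntegral.integral_congr fun x _ => ?_
  have hxy : 0 < ((x : ℂ) + (y : ℂ) * Complex.I).im := im_pos_of_pt hy
  have h0 : ofComplex (⟨0, y⟩ : ℂ) = ⟨⟨0, y⟩, hy⟩ := ofComplex_apply_of_im_pos (z := (⟨0, y⟩ : ℂ)) hy
  simp only [Function.comp_apply, ofComplex_apply_of_im_pos hxy, h0]
  congr 1
  ext1
  rw [UpperHalfPlane.coe_vadd]
  apply Complex.ext <;> simp

/-- **The constant term of an automorphic eigenfunction** (Theorem 3.1, zero-th term, at a cusp of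
width one): if `T_1 ∈ Γ`, `v` is `Γ`-automorphic and `C²` with `(Δ + s(1-s))v = 0`, `s ≠ 1/2`,
then `∫₀¹ v(x + iy) dx = A y^s + B y^{1-s}` for all `y > 0`. [cite: Iwaniec2002, Thm 3.1 & (3.4), PDF p. 41] -/
theorem cuspMean_eigenfunction_eq {v : ℍ → ℂ} (hva : IsAutomorphic Γ v)
    (hT : Matrix.GeneralLinearGroup.upperRightHom (1 : ℝ) ∈ Γ) (hvc : IsC2 v) {s : ℂ} (hs : s ≠ 1 / 2)
    (heig : ∀ z, hypLaplacian v z + s * (1 - s) * v z = 0) :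
    ∃ A B : ℂ, ∀ y : ℝ, 0 < y →
      cuspMean v (ofComplex ⟨0, y⟩) = A * (y : ℂ) ^ s + B * (y : ℂ) ^ (1 - s) := by
  obtain ⟨A, B, h⟩ := zeroMode_eq_cpow hvc (periodic_of_upperRightHom_mem hva hT)
    (eigen_ofComplex_complex heig) hs
  exact ⟨A, B, fun y hy => by rw [cuspMean_eq_intervalIntegral v hy]; exact h y hy⟩

/-- The same at a cusp `𝔞 = σ∞` with `σ⁻¹Γσ ∋ T_1`: `∫₀¹ v(σ(x + iy)) dx = A y^s + B y^{1-s}`.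
[cite: Iwaniec2002, Thm 3.1 & (3.2)–(3.4), PDF pp. 40–41] -/
theorem cuspMeanAt_eigenfunction_eq
    {v : ℍ → ℂ} (hva : IsAutomorphic Γ v) (hvc : IsC2 v) (σ : SL(2, ℝ))
    (hT : Matrix.GeneralLinearGroup.upperRightHom (1 : ℝ) ∈
      ConjAct.toConjAct (Matrix.SpecialLinearGroup.toGL σ : GL (Fin 2) ℝ)⁻¹ • Γ)
    {s : ℂ} (hs : s ≠ 1 / 2) (heig : ∀ z, hypLaplacian v z + s * (1 - s) * v z = 0) :
    ∃ A B : ℂ, ∀ y : ℝ, 0 < y →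
      Fuchsian.cuspMeanAt σ v (ofComplex ⟨0, y⟩) = A * (y : ℂ) ^ s + B * (y : ℂ) ^ (1 - s) := by
  set S : GL (Fin 2) ℝ := Matrix.SpecialLinearGroup.toGL σ with hS
  set v' : ℍ → ℂ := fun z => v (σ • z) with hv'
  have hdet : 0 < S.det.val := by simp [hS]
  have hv'c : IsC2 v' := hvc.comp_smul hdet
  have hv'a : IsAutomorphic (ConjAct.toConjAct S⁻¹ • Γ) v' := by
    intro γ' hγ' z
    have hδ : S * γ' * S⁻¹ ∈ Γ := (Fuchsian.mem_conj_inv_iff S γ').mp hγ'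
    simp only [hv']
    have e : σ • γ' • z = (S * γ' * S⁻¹) • (σ • z) := by
      rw [← toGL_smul_eq, ← toGL_smul_eq, mul_smul, mul_smul, inv_smul_smul]
    rw [e, hva _ hδ]
  have hv'e : ∀ z, hypLaplacian v' z + s * (1 - s) * v' z = 0 := by
    intro z
    simp only [hv']
    rw [show (fun z => v (σ • z)) = fun z => v (S • z) from rfl,
      hypLaplacian_comp_smul hdet v z (hvc.contDiffAt
        (UpperHalfPlane.isOpen_upperHalfPlaneSet.mem_nhds (S • z).im_pos))]
    exact heig _
  exact cuspMean_eigenfunction_eq hv'a hT hv'c hs hv'e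

end CuspMean

/-! ## 4. The constant terms of the Eisenstein series: `δ_𝔞𝔟 y^s + φ_𝔞𝔟(s) y^{1-s}` -/

namespace Fuchsian

section Scattering

open UpperHalfPlane
open scoped MatrixGroups _root_.Pointwise

variable {Γ : Subgroup (GL (Fin 2) ℝ)} {h : ℕ} {𝔞 : Fin h → OnePoint ℝ} {σ : Fin h → SL(2, ℝ)}

/-- `ofComplex i = i`. [folklore] -/
theorem ofComplex_I : ofComplex (⟨0, 1⟩ : ℂ) = UpperHalfPlane.I := by
  rw [ofComplex_apply_of_im_pos (z := (⟨0, 1⟩ : ℂ)) (by norm_num : (0 : ℝ) < 1)]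
  rfl

variable (Γ σ) in
/-- **The scattering coefficient `φ_𝔞ᵢ𝔞ⱼ(s)`** of a system of cusps with width-one scaling
matrices, defined for every `s` as the coefficient of `y^{1-s}` in the constant term of
`E_𝔞ᵢ(σⱼ z, s)` read off at height `1`: `φᵢⱼ(s) = ∫₀¹ E_𝔞ᵢ(σⱼ(x + i), s) dx - δᵢⱼ`
(justified by `cuspMeanAt_eisCusp`; in the book `φ_𝔞𝔟(s) = π^{1/2} Γ(s - 1/2)Γ(s)⁻¹ Σ_c c^{-2s} S_𝔞𝔟(0, 0; c)`,
(3.21)–(3.22), a formula we do not need). [cite: Iwaniec2002, Thm 3.4 & (3.20)–(3.22), PDF pp. 45–46] -/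
def eisScattering (i j : Fin h) (s : ℂ) : ℂ :=
  cuspMeanAt (σ j) (fun z => eisCusp Γ (σ i) z s) UpperHalfPlane.I - if i = j then 1 else 0

/-- **Pointwise bound for the constant term**: `|∫₀¹ E_𝔞ᵢ(σⱼ(x+iy), s) dx - δᵢⱼ y^s| ≤ (c(σ)/2)(y^{-σ} + y^{1-σ})`
for all `y > 0` (average of `FuchsianEisensteinGrowth` over the horocycle). [cite: Iwaniec2002, (3.20), PDF p. 46] -/
theorem norm_cuspMeanAt_eisCusp_sub_le
    (hΓ : Γ ≤ (Matrix.SpecialLinearGroup.toGL : SL(2, ℝ) →* GL (Fin 2) ℝ).range)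
    (hneg : (-1 : GL (Fin 2) ℝ) ∈ Γ) (hd : IsDiscreteSubgroup Γ)
    (hinfty : ∀ i, (Matrix.SpecialLinearGroup.toGL (σ i) : GL (Fin 2) ℝ) • (OnePoint.infty : OnePoint ℝ) = 𝔞 i)
    (hper : ∀ i, (ConjAct.toConjAct (Matrix.SpecialLinearGroup.toGL (σ i) : GL (Fin 2) ℝ)⁻¹ • Γ).strictPeriods =
      AddSubgroup.zmultiples 1)
    (hineq : ∀ i j, ∀ γ ∈ Γ, γ • 𝔞 i = 𝔞 j → i = j)
    {s : ℂ} (hs : 1 < s.re) (i j : Fin h) {y : ℝ} (hy : 0 < y) :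
    ‖cuspMeanAt (σ j) (fun z => eisCusp Γ (σ i) z s) (ofComplex ⟨0, y⟩) -
        (if i = j then ((y : ℝ) : ℂ) ^ s else 0)‖ ≤
      eisGrowthConst s.re / 2 * (y ^ (-s.re) + y ^ (1 - s.re)) := by
  set E : ℍ → ℂ := fun z => eisCusp Γ (σ i) z s with hE
  set g : ℝ → ℂ := fun x => E (σ j • ((x : ℝ) +ᵥ ofComplex ⟨0, y⟩)) -
    (if i = j then ((y : ℝ) : ℂ) ^ s else 0) with hg
  have h0 : ofComplex (⟨0, y⟩ : ℂ) = ⟨⟨0, y⟩, hy⟩ := ofComplex_apply_of_im_pos (z := (⟨0, y⟩ : ℂ)) hy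
  have him : ∀ x : ℝ, ((x : ℝ) +ᵥ ofComplex (⟨0, y⟩ : ℂ)).im = y := by
    intro x; rw [h0, UpperHalfPlane.vadd_im]; rfl
  have hbound : ∀ x : ℝ, ‖g x‖ ≤ eisGrowthConst s.re / 2 * (y ^ (-s.re) + y ^ (1 - s.re)) := by
    intro x
    simp only [hg, hE]
    by_cases hij : i = j
    · subst hij
      rw [if_pos rfl]
      have h := norm_eisCusp_frame_sub_cpow_le hΓ hneg hd hper hs i ((x : ℝ) +ᵥ ofComplex ⟨0, y⟩)
      rwa [him x] at h
    · rw [if_neg hij, sub_zero]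
      have h := norm_eisCusp_frame_le_of_ne hΓ hd hinfty hper hineq hs hij ((x : ℝ) +ᵥ ofComplex ⟨0, y⟩)
      rwa [him x] at h
  have hT : Matrix.GeneralLinearGroup.upperRightHom (1 : ℝ) ∈
      ConjAct.toConjAct (Matrix.SpecialLinearGroup.toGL (σ i) : GL (Fin 2) ℝ)⁻¹ • Γ :=
    upperRightHom_one_mem_of_periods (hper i)
  have hEc : Continuous E := (isC2_and_eigen_eisCusp hΓ hd (σ i) hT hs).1
  have hvc : Continuous fun x : ℝ => (x : ℝ) +ᵥ ofComplex (⟨0, y⟩ : ℂ) :=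
    continuous_vadd₂.comp (continuous_id.prodMk continuous_const)
  have hint : IntervalIntegrable (fun x : ℝ => E (σ j • ((x : ℝ) +ᵥ ofComplex (⟨0, y⟩ : ℂ))))
      volume 0 1 :=
    (hEc.comp ((continuous_const_smul (σ j)).comp hvc)).intervalIntegrable _ _
  have e : cuspMeanAt (σ j) E (ofComplex ⟨0, y⟩) - (if i = j then ((y : ℝ) : ℂ) ^ s else 0) =
      ∫ x in (0 : ℝ)..1, g x := by
    rw [cuspMeanAt_apply, hg, intervalIntegral.integral_sub hint intervalIntegrable_const,
      intervalIntegral.integral_const]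
    simp
  rw [e]
  have h := intervalIntegral.norm_integral_le_of_norm_le_const (a := (0 : ℝ)) (b := 1)
    (C := eisGrowthConst s.re / 2 * (y ^ (-s.re) + y ^ (1 - s.re))) fun x _ => hbound x
  simpa using h

/-- `(A - δ) y^s + B y^{1-s} = O(y^{-σ} + y^{1-σ})` on `y > 0` with `σ > 1/2` forces `A = δ`. [folklore] -/
theorem coeff_eq_of_growth {A B : ℂ} {σ C : ℝ} (hσ : 1 / 2 < σ) {s : ℂ} (hs : s.re = σ)
    (h : ∀ y : ℝ, 1 ≤ y → ‖A * (y : ℂ) ^ s + B * (y : ℂ) ^ (1 - s)‖ ≤ C * (y ^ (-σ) + y ^ (1 - σ))) :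
    A = 0 := by
  by_contra hA
  have hA' : 0 < ‖A‖ := norm_pos_iff.mpr hA
  -- `‖A‖ y^σ ≤ (2|C| + ‖B‖) y^{1-σ}` for `y ≥ 1`
  have key : ∀ y : ℝ, 1 ≤ y → ‖A‖ ≤ (2 * |C| + ‖B‖) * y ^ (1 - 2 * σ) := by
    intro y hy
    have hy0 : 0 < y := by linarith
    have hn1 : ‖(y : ℂ) ^ s‖ = y ^ σ := by rw [Complex.norm_cpow_eq_rpow_re_of_pos hy0, hs]
    have hn2 : ‖(y : ℂ) ^ (1 - s)‖ = y ^ (1 - σ) := by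
      rw [Complex.norm_cpow_eq_rpow_re_of_pos hy0]; simp [hs]
    have h1 : ‖A‖ * y ^ σ ≤ C * (y ^ (-σ) + y ^ (1 - σ)) + ‖B‖ * y ^ (1 - σ) := by
      have := h y hy
      calc ‖A‖ * y ^ σ = ‖A * (y : ℂ) ^ s‖ := by rw [norm_mul, hn1]
        _ ≤ ‖A * (y : ℂ) ^ s + B * (y : ℂ) ^ (1 - s)‖ + ‖B * (y : ℂ) ^ (1 - s)‖ := norm_le_add_norm_add _ _
        _ ≤ C * (y ^ (-σ) + y ^ (1 - σ)) + ‖B‖ * y ^ (1 - σ) := by rw [norm_mul, hn2]; linarith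
    have hp1 : y ^ (-σ) ≤ y ^ (1 - σ) := Real.rpow_le_rpow_of_exponent_le hy (by linarith)
    have hp0 : 0 ≤ y ^ (-σ) := by positivity
    have hp2 : 0 ≤ y ^ (1 - σ) := by positivity
    have h2 : C * (y ^ (-σ) + y ^ (1 - σ)) ≤ 2 * |C| * y ^ (1 - σ) := by
      have := le_abs_self C
      nlinarith [abs_nonneg C]
    have h3 : ‖A‖ * y ^ σ ≤ (2 * |C| + ‖B‖) * y ^ (1 - σ) := by nlinarith
    have e : y ^ (1 - σ) = y ^ σ * y ^ (1 - 2 * σ) := by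
      rw [← Real.rpow_add hy0]; congr 1; ring
    rw [e] at h3
    have hyσ : 0 < y ^ σ := by positivity
    nlinarith [mul_nonneg (by positivity : (0 : ℝ) ≤ 2 * |C| + ‖B‖) (Real.rpow_nonneg hy0.le (1 - 2 * σ))]
  -- but `y^{1-2σ} → 0`
  have ht : Tendsto (fun y : ℝ => (2 * |C| + ‖B‖) * y ^ (1 - 2 * σ)) atTop (nhds 0) := by
    have := (tendsto_rpow_neg_atTop (y := 2 * σ - 1) (by linarith)).const_mul (2 * |C| + ‖B‖)
    rw [mul_zero] at this
    refine this.congr fun y => ?_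
    congr 1; congr 1; ring
  have hev := (ht.eventually (gt_mem_nhds hA')).and (eventually_ge_atTop 1)
  obtain ⟨y, hy1, hy2⟩ := hev.exists
  exact absurd (key y hy2) (not_le.mpr hy1)

/-- **Theorem 3.4, constant term, for a general finite volume group**: for a system of inequivalent
cusps `𝔞ᵢ = σᵢ∞` with width-one scaling matrices (`-1 ∈ Γ`) and `Re s > 1`,
`∫₀¹ E_𝔞ᵢ(σⱼ(x + iy), s) dx = δᵢⱼ y^s + φᵢⱼ(s) y^{1-s}` for all `y > 0`
(`φᵢⱼ = eisScattering Γ σ i j`): the zero-th coefficient of the Fourier expansion (3.20) of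
`E_𝔞(σ_𝔟z, s)`. Proof: the cusp mean of the automorphic `C²` eigenfunction `E_𝔞ᵢ(·, s)` at `𝔞ⱼ`
solves the Euler equation, so equals `A y^s + B y^{1-s}` (Theorem 3.1); the growth bound (3.20)
in the frames (`FuchsianEisensteinGrowth`) forces `A = δᵢⱼ`, and `B` is read off at `y = 1`.
[cite: Iwaniec2002, Thm 3.4 (3.20), PDF pp. 45–46; Thm 3.1, PDF p. 41] -/
theorem cuspMeanAt_eisCusp
    (hΓ : Γ ≤ (Matrix.SpecialLinearGroup.toGL : SL(2, ℝ) →* GL (Fin 2) ℝ).range)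
    (hneg : (-1 : GL (Fin 2) ℝ) ∈ Γ) (hd : IsDiscreteSubgroup Γ)
    (hinfty : ∀ i, (Matrix.SpecialLinearGroup.toGL (σ i) : GL (Fin 2) ℝ) • (OnePoint.infty : OnePoint ℝ) = 𝔞 i)
    (hper : ∀ i, (ConjAct.toConjAct (Matrix.SpecialLinearGroup.toGL (σ i) : GL (Fin 2) ℝ)⁻¹ • Γ).strictPeriods =
      AddSubgroup.zmultiples 1)
    (hineq : ∀ i j, ∀ γ ∈ Γ, γ • 𝔞 i = 𝔞 j → i = j)
    {s : ℂ} (hs : 1 < s.re) (i j : Fin h) {y : ℝ} (hy : 0 < y) :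
    cuspMeanAt (σ j) (fun z => eisCusp Γ (σ i) z s) (ofComplex ⟨0, y⟩) =
      (if i = j then ((y : ℝ) : ℂ) ^ s else 0) + eisScattering Γ σ i j s * ((y : ℝ) : ℂ) ^ (1 - s) := by
  set E : ℍ → ℂ := fun z => eisCusp Γ (σ i) z s with hE
  have hT : Matrix.GeneralLinearGroup.upperRightHom (1 : ℝ) ∈
      ConjAct.toConjAct (Matrix.SpecialLinearGroup.toGL (σ i) : GL (Fin 2) ℝ)⁻¹ • Γ :=
    upperRightHom_one_mem_of_periods (hper i)
  obtain ⟨-, hEC2, hEeig⟩ := isC2_and_eigen_eisCusp hΓ hd (σ i) hT hs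
  have hEa : IsAutomorphic Γ E := isAutomorphic_eisCusp hΓ (σ i) s
  have hs2 : s ≠ 1 / 2 := by
    intro h; rw [h] at hs; norm_num at hs
  obtain ⟨A, B, hAB⟩ := cuspMeanAt_eigenfunction_eq hEa hEC2 (σ j)
    (upperRightHom_one_mem_of_periods (hper j)) hs2 hEeig
  set δ : ℂ := if i = j then 1 else 0 with hδ
  have hδy : ∀ y : ℝ, (if i = j then ((y : ℝ) : ℂ) ^ s else 0) = δ * ((y : ℝ) : ℂ) ^ s := by
    intro y; simp only [hδ]; split_ifs <;> simp
  -- `A = δ`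
  have hA : A - δ = 0 := by
    refine coeff_eq_of_growth (B := B) (σ := s.re) (C := eisGrowthConst s.re / 2) (by linarith) rfl
      fun y hy1 => ?_
    have hy0 : 0 < y := by linarith
    have h := norm_cuspMeanAt_eisCusp_sub_le hΓ hneg hd hinfty hper hineq hs i j hy0
    rw [hAB y hy0, hδy] at h
    have e : A * ((y : ℝ) : ℂ) ^ s + B * ((y : ℝ) : ℂ) ^ (1 - s) - δ * ((y : ℝ) : ℂ) ^ s =
        (A - δ) * ((y : ℝ) : ℂ) ^ s + B * ((y : ℝ) : ℂ) ^ (1 - s) := by ring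
    rw [e] at h
    exact h
  have hA' : A = δ := sub_eq_zero.mp hA
  -- `B = φᵢⱼ(s)` from `y = 1`
  have hB : B = eisScattering Γ σ i j s := by
    have h1 := hAB 1 one_pos
    rw [hA'] at h1
    simp only [Complex.ofReal_one, Complex.one_cpow, mul_one] at h1
    rw [eisScattering, ← ofComplex_I, show (fun z => eisCusp Γ (σ i) z s) = E from rfl, h1, hδ]
    ring
  rw [hAB y hy, hA', hB, hδy]

/-- **`|φᵢⱼ(s)| ≤ c(σ)` uniformly in `Im s`** (`σ = Re s > 1`; from the bound at `y = 1`).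
[cite: Iwaniec2002, (3.20)–(3.22), PDF p. 46] -/
theorem norm_eisScattering_le
    (hΓ : Γ ≤ (Matrix.SpecialLinearGroup.toGL : SL(2, ℝ) →* GL (Fin 2) ℝ).range)
    (hneg : (-1 : GL (Fin 2) ℝ) ∈ Γ) (hd : IsDiscreteSubgroup Γ)
    (hinfty : ∀ i, (Matrix.SpecialLinearGroup.toGL (σ i) : GL (Fin 2) ℝ) • (OnePoint.infty : OnePoint ℝ) = 𝔞 i)
    (hper : ∀ i, (ConjAct.toConjAct (Matrix.SpecialLinearGroup.toGL (σ i) : GL (Fin 2) ℝ)⁻¹ • Γ).strictPeriods =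
      AddSubgroup.zmultiples 1)
    (hineq : ∀ i j, ∀ γ ∈ Γ, γ • 𝔞 i = 𝔞 j → i = j)
    {s : ℂ} (hs : 1 < s.re) (i j : Fin h) :
    ‖eisScattering Γ σ i j s‖ ≤ eisGrowthConst s.re := by
  have h := norm_cuspMeanAt_eisCusp_sub_le hΓ hneg hd hinfty hper hineq hs i j one_pos
  rw [cuspMeanAt_eisCusp hΓ hneg hd hinfty hper hineq hs i j one_pos] at h
  simp only [Complex.ofReal_one, Complex.one_cpow, mul_one, add_sub_cancel_left, Real.one_rpow] at h
  linarith

end Scattering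

end Fuchsian

end Literature.NumberTheory.Automorphic

end
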